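import Mathlib.RingTheory.AlgebraicIndependent.Basic
import Mathlib.RingTheory.AlgebraicIndependent.TranscendenceBasis
import Mathlib.RingTheory.AlgebraicIndependent.Transcendental
import Mathlib.FieldTheory.IntermediateField.Adjoin.Defs
import Mathlib.RingTheory.IntegralClosure.IntegrallyClosed
import Mathlib.FieldTheory.RatFunc.Basic
import Mathlib.FieldTheory.RatFunc.AsPolynomial
import Mathlib.FieldTheory.RatFunc.IntermediateField
import Mathlib.AlgebraicGeometry.EllipticCurve.Affine.Point
import Literature.NumberTheory.DiophantineGeometry.FunctionFieldDivisors
import Literature.NumberTheory.EllipticCurves.FunctionFieldPlaces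
import HarnessLib

-- provenance: harness21/H21/H21/Prelude/ArithGeomL/FunctionFieldGenus.lean @ 72ee61a (interim HEAD d8f2665); M5 mechanical rewrite
/-!
# Algebraic function fields of one variable: genus and Riemann–Roch
(trunk ArithGeomL, item C6 `FunctionFieldGenus`; notion `curve_genus`, part 2)

Continuing `FunctionFieldDivisors` (places `PlaceOver K F`, divisors, `L(D)`, `ℓ(D)` of an
extension `F/K`), this file introduces the hypothesis under which those objects behave as in
the textbooks and states the classical theorems, following Stichtenoth, *Algebraic Function
Fields and Codes*, §§I.4–I.5 and V.1, and Rosen, *Number Theory in Function Fields*, Ch. 5–6.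

## Main definitions

* `Literature.IsAlgFunctionField K F` (a `Prop`-valued mixin on `[Algebra K F]`): `trdeg_K F = 1` and
  `F/K` finitely generated. Instance: `IsAlgFunctionField K (RatFunc K)` (`sorry`-free).
* `AlgFunctionField.genusSet K F`, `AlgFunctionField.genus K F : ℕ`: Stichtenoth's genus
  `max_D (deg D - ℓ(D) + 1)` (Def. I.4.15).
* `AlgFunctionField.Divisor.IsCanonical W`: `deg W = 2g - 2 ∧ ℓ(W) = g`.
* `AlgFunctionField.ratPlaces K F`: the places of degree one.
* Bridge to G16 (`Literature.Prelude.EllArithM.FunctionFieldPlaces`): `PlaceOver.toPlace :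
  PlaceOver Fq F → Literature.FunctionField.Place F` (injective, REAL), `toPlace_bijective`,
  `degree_toPlace`, `isGenus_genus : FunctionField.IsGenus Fq F (genus Fq F)`.

## Main statements (all `sorry`, known theorems)

`IsAlgFunctionField.isDiscreteValuationRing_of_ne_top` (Stichtenoth I.1.6), the finiteness
theorems `PlaceOver.finiteDimensional_residueField`, `finite_setOf_ord_ne_zero`,
`finiteDimensional_riemannRochSpace` (each kills a documented junk value of
`FunctionFieldDivisors`), `ell_zero`, `ell_le_degree_add_one`, Riemann's theorem
`bddAbove_genusSet` (kills the junk value of `genus`), `degree_add_one_sub_ell_le_genus`,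
the Riemann–Roch theorem `riemann_roch` (I.5.15) and `ell_eq_of_lt_degree` (I.5.17),
`genus_ratFunc`, `genus_functionField_weierstrass`, `infinite_ratPlaces_ratFunc`.

## Three genera in H21

`Literature.NumberTheory.DiophantineGeometry.genus` (Betti number of `X(ℂ)`, `Statements/Abc/Sweep1`), G16's
`Literature.FunctionField.IsGenus Fq F g` (Weil-zeta form, global function fields only) and this file's
`Literature.AlgFunctionField.genus K F` (Riemann–Roch). Only the bridge to G16 is stated
(`isGenus_genus`); the comparison `2 * genus K K(X) = b₁(X(ℂ))` needs `Scheme.functionField` as a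
`K`-algebra and GAGA and is recorded as open in the outline (§4.4), not stated.

## Mathlib anchors and searches

`Algebra.trdeg`, `trdeg_add_eq`, `Polynomial.trdeg_of_isDomain`, `IsLocalization.isAlgebraic`,
`IntermediateField.FG`, `RatFunc.adjoin_X`, `IsIntegrallyClosedIn`,
`WeierstrassCurve.Affine.FunctionField` (`= FractionRing W.CoordinateRing`, a `K`-algebra by
Mathlib's `FractionRing` instances, checked by `example`s). Mathlib's `FunctionField Fq F` is
`FiniteDimensional (RatFunc Fq) F` over a *chosen* `[Algebra (RatFunc Fq) F]` and is not used
(the genus must not depend on `T`). Mathlib has Lüroth (`Mathlib.FieldTheory.RatFunc.Luroth`)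
but no genus, no Riemann–Roch for function fields, no canonical divisor (searched `genus`,
`riemannRoch`, `RiemannRoch`, `canonical` in `FieldTheory`/`RingTheory`/`NumberTheory`/
`AlgebraicGeometry`): everything below is new.

## Design notes

* Namespaces (outline review 3): the class is `Literature.NumberTheory.DiophantineGeometry.IsAlgFunctionField` with its own lemmas in
  `Literature.IsAlgFunctionField.*`; everything else is in `Literature.AlgFunctionField`, disjoint from G16's
  `Literature.FunctionField.*`.
* "`K` is the full constant field" is Mathlib's `[IsIntegrallyClosedIn K F]`; G16 uses
  `IsFullConstantField Fq F := algebraicClosure Fq F = ⊥` (equivalent, see `isGenus_genus`).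
* `genus` is an `sSup` over `ℕ`, junk `0` if unbounded (never: `bddAbove_genusSet`).
* `Divisor.IsCanonical` is defined numerically (`deg W = 2g - 2`, `ℓ(W) = g`), which by
  Stichtenoth Prop. I.6.2 characterises the canonical class; Weil differentials are not
  developed.
* The bridge section is universe-monomorphic (`Fq F : Type`) because G16's `Place F` is.

## References

* H. Stichtenoth, *Algebraic Function Fields and Codes*, GTM 254, §§I.1, I.4–I.6, V.1–V.2.
* M. Rosen, *Number Theory in Function Fields*, GTM 210, Ch. 5–6.
* C. Chevalley, *Introduction to the Theory of Algebraic Functions of One Variable*, AMS 1951.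
* A. Weil, *Sur les courbes algébriques et les variétés qui s'en déduisent*, Hermann 1948.
-/

noncomputable section

open scoped Classical

namespace Literature.NumberTheory.DiophantineGeometry

universe u v

/-- `IsAlgFunctionField K F`: `F/K` is an *algebraic function field of one variable*, i.e.
`F` has transcendence degree `1` over `K` and is finitely generated over `K` as a field
(Stichtenoth, *Algebraic Function Fields and Codes*, Def. I.1.1; Rosen Ch. 5; Chevalley 1951,
Ch. I). Equivalently `F` is a finite extension of `K(x)` for some (any) transcendental `x ∈ F`.

This is a `Prop`-valued mixin on `[Algebra K F]`. It is deliberately *not* Mathlib's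
`FunctionField Fq F`, which is the class `FiniteDimensional (RatFunc Fq) F` over a *chosen*
`[Algebra (RatFunc Fq) F]`, i.e. it fixes a distinguished transcendental `T`; the genus and the
places of `F/K` do not depend on such a choice, so we only assume `[Algebra K F]`.
`K` need not be the full constant field; statements needing that carry Mathlib's
`[IsIntegrallyClosedIn K F]` (every element of `F` algebraic over `K` lies in `K`). [cite: Chevalley1951, Ch. I] -/
class IsAlgFunctionField (K : Type u) (F : Type v) [Field K] [Field F] [Algebra K F] : Prop where
  /-- `F` has transcendence degree one over `K`. -/
  trdeg_eq_one : Algebra.trdeg K F = 1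
  /-- `F` is finitely generated over `K` as a field. -/
  fg_top : (⊤ : IntermediateField K F).FG

namespace IsAlgFunctionField

/-- The rational function field `K(X)` is an algebraic function field of one variable over `K`
(Stichtenoth §I.2). Proof: `trdeg_K K(X) = trdeg_K K[X] + trdeg_{K[X]} K(X) = 1 + 0`
(Mathlib `trdeg_add_eq`, `Polynomial.trdeg_of_isDomain`, `IsLocalization.isAlgebraic`) and
`K(X) = K⟮X⟯` (Mathlib `RatFunc.adjoin_X`). No Mathlib instance of this class exists (the class
is new), so nothing is overridden. [folklore] -/
instance ratFunc (K : Type u) [Field K] : IsAlgFunctionField K (RatFunc K) where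
  trdeg_eq_one := by
    haveI : Algebra.IsAlgebraic (Polynomial K) (RatFunc K) :=
      IsLocalization.isAlgebraic (RatFunc K) (nonZeroDivisors (Polynomial K))
    have h := trdeg_add_eq K (Polynomial K) (A := RatFunc K)
    rwa [Polynomial.trdeg_of_isDomain, trdeg_eq_zero, add_zero, eq_comm] at h
  fg_top := ⟨{RatFunc.X}, by simpa using RatFunc.adjoin_X (K := K)⟩

variable {K : Type u} {F : Type v} [Field K] [Field F] [Algebra K F]

/-- In an algebraic function field of one variable `F/K`, every valuation ring `O` of `F` with
`K ⊆ O ⊊ F` is a discrete valuation ring (Stichtenoth Thm. I.1.6; Chevalley 1951, I §2). This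
justifies the DVR field of `AlgFunctionField.PlaceOver`. (Distinct from the G16 theorem
`Literature.NumberTheory.EllipticCurves.FunctionField.isDiscreteValuationRing_of_ne_top` for global function fields.) [cite: Chevalley1951, I §2] -/
def isDiscreteValuationRing_of_ne_top : Prop :=
  ∀ [IsAlgFunctionField K F] (O : ValuationSubring F) (hO : O ≠ ⊤) (hK : ∀ c : K, algebraMap K F c ∈ O),
    IsDiscreteValuationRing O

end IsAlgFunctionField

namespace AlgFunctionField

variable {K : Type u} {F : Type v} [Field K] [Field F] [Algebra K F]

/-! ### Finiteness theorems (kill the junk values of `FunctionFieldDivisors`) -/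

/-- The residue field `F_v` of a place of an algebraic function field of one variable `F/K` is a
finite extension of `K` (Stichtenoth Prop. I.1.15: `deg v ≤ [F : K(x)]` for any `x` with
`v(x) ≠ 0`). Kills the junk value of `PlaceOver.degree`. [cite: Stichtenoth2009, Prop. I.1.15] -/
def PlaceOver.finiteDimensional_residueField : Prop :=
  ∀ [IsAlgFunctionField K F] (v : PlaceOver K F),
    FiniteDimensional K v.residueField

/-- The degree of a place of a function field of one variable is positive, `0 < deg v`
(Stichtenoth Def. I.1.14, Prop. I.1.15: `F_v ⊇ K` is a nonzero finite-dimensional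
`K`-space). [cite: Stichtenoth2009, Def. I.1.14 and Prop. I.1.15] -/
def PlaceOver.degree_pos : Prop :=
  ∀ [IsAlgFunctionField K F] (v : PlaceOver K F),
    0 < v.degree

/-- An algebraic function field of one variable has infinitely many places
(Stichtenoth Cor. I.3.2). [cite: Stichtenoth2009, Cor. I.3.2] -/
def infinite_placeOver : Prop :=
  ∀ [IsAlgFunctionField K F],
    Infinite (PlaceOver K F)

/-- A nonzero element of a function field of one variable has only finitely many zeros and
poles: `{v | ord_v x ≠ 0}` is finite (Stichtenoth Cor. I.3.4). Kills the junk value of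
`principalDivisor`. [cite: Stichtenoth2009, Cor. I.3.4] -/
def finite_setOf_ord_ne_zero : Prop :=
  ∀ [IsAlgFunctionField K F] {x : F} (hx : x ≠ 0),
    {v : PlaceOver K F | v.ord x ≠ 0}.Finite

/-- The Riemann–Roch space `L(D)` of a divisor of a function field of one variable is
finite-dimensional over `K` (Stichtenoth Prop. I.4.9). Kills the junk value of `ell`. [cite: Stichtenoth2009, Prop. I.4.9] -/
def finiteDimensional_riemannRochSpace : Prop :=
  ∀ [IsAlgFunctionField K F] (D : Divisor K F),
    FiniteDimensional K (riemannRochSpace D)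

/-- `L(0) = K`, hence `ℓ(0) = 1`, when `K` is the full constant field of the function field
`F/K` (Stichtenoth Lemma I.4.7 (a), Cor. I.1.20). [cite: Stichtenoth2009, Lemma I.4.7(a) and Cor. I.1.20] -/
def ell_zero : Prop :=
  ∀ [IsAlgFunctionField K F] [IsIntegrallyClosedIn K F],
    ell (0 : Divisor K F) = 1

/-- For a divisor of nonnegative degree, `ℓ(D) ≤ deg D + 1`, when `K` is the full constant
field of `F/K` (Stichtenoth Prop. I.4.9 (b) applied to an effective divisor linearly equivalent
to `D` when `ℓ(D) > 0`, eq. (I.4.16); Rosen Lemma 5.4). [cite: Stichtenoth2009, Prop. I.4.9(b) and (I.4.16)] [cite: RosenFunctionFields2002, Lemma 5.4] -/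
def ell_le_degree_add_one : Prop :=
  ∀ [IsAlgFunctionField K F] [IsIntegrallyClosedIn K F] (D : Divisor K F) (hD : 0 ≤ D.degree),
    (ell D : ℤ) ≤ D.degree + 1

/-! ### The genus and the Riemann–Roch theorem -/

variable (K F) in
/-- The set `{deg D + 1 - ℓ(D) | D ∈ Div(F/K)} ∩ ℕ` whose supremum is the genus
(Stichtenoth Def. I.4.15). Negative values of `deg D + 1 - ℓ(D)` are discarded (they never
realise the maximum: `D = 0` gives `0` when `K` is the full constant field). [folklore] -/
def genusSet : Set ℕ :=
  {g | ∃ D : Divisor K F, (g : ℤ) = D.degree + 1 - ell D}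

variable (K F) in
/-- The *genus* `g = max {deg D - ℓ(D) + 1 | D ∈ Div(F/K)}` of `F/K` (Stichtenoth Def. I.4.15;
Rosen Ch. 5; Riemann 1857). Junk value `0` (`Nat.sSup` of an unbounded or empty set) if
`genusSet K F` is unbounded, which never happens for an algebraic function field of one variable
by Riemann's theorem `bddAbove_genusSet` (Stichtenoth Prop. I.4.14); `genusSet` is nonempty when
`K` is the full constant field (`zero_mem_genusSet`). This is the third notion of genus in H21,
next to `Literature.NumberTheory.DiophantineGeometry.genus` (Betti) and G16's `Literature.NumberTheory.EllipticCurves.FunctionField.IsGenus` (Weil zeta); see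
`isGenus_genus` for the bridge to the latter. [cite: Riemann1857] -/
def genus : ℕ :=
  sSup (genusSet K F)

/-- `0 ∈ genusSet K F`, witnessed by `D = 0` (`deg 0 + 1 - ℓ(0) = 0` by `ell_zero`). [folklore] -/
def zero_mem_genusSet : Prop :=
  ∀ [IsAlgFunctionField K F] [IsIntegrallyClosedIn K F],
    0 ∈ genusSet K F

/- interim proof relied on results that are now named facts (D-0014); demoted to a fact by the M5 import, proof preserved:
:=
  ⟨0, by simp [ell_zero]⟩
-/

/-- **Riemann's theorem** (boundedness half): `deg D + 1 - ℓ(D)` is bounded above as `D` ranges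
over all divisors of an algebraic function field of one variable (Stichtenoth Prop. I.4.14;
Rosen Lemma 5.6). Kills the junk value of `genus`. [cite: Stichtenoth2009, Prop. I.4.14] [cite: RosenFunctionFields2002, Lemma 5.6] -/
def bddAbove_genusSet : Prop :=
  ∀ [IsAlgFunctionField K F],
    BddAbove (genusSet K F)

/-- Riemann's inequality `ℓ(D) ≥ deg D + 1 - g`, in the form `deg D + 1 - ℓ(D) ≤ g`
(Stichtenoth Thm. I.4.17 (a); Rosen Thm. 5.4). [cite: Stichtenoth2009, Thm. I.4.17(a)] [cite: RosenFunctionFields2002, Thm. 5.4] -/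
def degree_add_one_sub_ell_le_genus : Prop :=
  ∀ [IsAlgFunctionField K F] (D : Divisor K F),
    D.degree + 1 - ell D ≤ (genus K F : ℤ)

/-- A divisor `W` is *canonical* if `deg W = 2g - 2` and `ℓ(W) = g` (Stichtenoth Prop. I.6.2:
these two numerical conditions characterise the canonical class, Cor. I.5.16; we take them as
the definition to avoid Weil differentials / adèles). [folklore] -/
def Divisor.IsCanonical (W : Divisor K F) : Prop :=
  W.degree = 2 * (genus K F : ℤ) - 2 ∧ ell W = genus K F

/-- The **Riemann–Roch theorem** (Stichtenoth Thm. I.5.15, Cor. I.5.16; Rosen Thm. 5.4; Roch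
1865, F. K. Schmidt 1931 for general constant fields): there is a canonical divisor `W` with
`ℓ(D) = deg D + 1 - g + ℓ(W - D)` for every divisor `D` of `F/K` (`K` the full constant
field). [cite: Schmidt1931, for general constant fields] -/
def riemann_roch : Prop :=
  ∀ [IsAlgFunctionField K F] [IsIntegrallyClosedIn K F],
    ∃ W : Divisor K F, W.IsCanonical ∧
      ∀ D : Divisor K F, (ell D : ℤ) = D.degree + 1 - genus K F + ell (W - D)

/-- Riemann–Roch for divisors of large degree: if `deg D > 2g - 2` then
`ℓ(D) = deg D + 1 - g` (Stichtenoth Thm. I.5.17; Rosen Cor. to Thm. 5.4). [cite: Stichtenoth2009, Thm. I.5.17] -/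
def ell_eq_of_lt_degree : Prop :=
  ∀ [IsAlgFunctionField K F] [IsIntegrallyClosedIn K F] {D : Divisor K F} (h : 2 * (genus K F : ℤ) - 2 < D.degree),
    (ell D : ℤ) = D.degree + 1 - genus K F

/-! ### Rational places -/

variable (K F) in
/-- The set of *rational places* (places of degree one, `F_v = K`) of `F/K`
(Stichtenoth Def. I.1.14, §V.1 `N(F) = #{P | deg P = 1}`). When `F = K(X)` is the function
field of a smooth projective geometrically irreducible curve `X/K`, rational places correspond
bijectively to `K`-rational points `X(K)` (Stichtenoth I.1, Hartshorne I.6 and II.6.7–6.9: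
closed points of the regular projective model ↔ places, residue field `K` ↔ degree one); this is
the form in which `Statements/Abc/MordellFunctionField` states finiteness of `X(K)`. [folklore] -/
def ratPlaces : Set (PlaceOver K F) :=
  {v | v.IsRational}

/-- Membership in `ratPlaces` (definitional). [folklore] -/
@[simp]
theorem mem_ratPlaces (v : PlaceOver K F) : v ∈ ratPlaces K F ↔ v.IsRational :=
  Iff.rfl

end AlgFunctionField

/-! ### Examples: `K(X)` and function fields of elliptic curves -/

namespace AlgFunctionField

/-- The rational function field `K(X)/K` has genus `0` (Stichtenoth Ex. I.4.18; Rosen Ch. 5). [cite: Stichtenoth2009, Example I.4.18] -/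
def genus_ratFunc : Prop :=
  ∀ (K : Type u) [Field K],
    genus K (RatFunc K) = 0

/- Instance checks for `genus_functionField_weierstrass`: Mathlib's
`WeierstrassCurve.Affine.FunctionField W = FractionRing W.CoordinateRing` is a `K`-algebra through
`K → K[X] → K[W] → Frac K[W]` (Mathlib's `FractionRing` algebra instance). -/
example (K : Type u) [Field K] (W : WeierstrassCurve.Affine K) : Algebra K W.FunctionField :=
  inferInstance
example (K : Type u) [Field K] (W : WeierstrassCurve.Affine K) :
    IsScalarTower K W.CoordinateRing W.FunctionField :=
  inferInstance

/-- The function field `K(E) = Frac (K[X, Y]/(Weierstrass equation))` of an elliptic curve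
`E/K` (Mathlib `WeierstrassCurve.Affine.FunctionField`) has genus `1`
(Silverman, *AEC*, Prop. III.3.1 (c) with Hartshorne IV.1; Stichtenoth Prop. VI.1.3 for
`char K ≠ 2`). [cite: SilvermanAEC2009, Prop. III.3.1(c)] [cite: Stichtenoth2009, Prop. VI.1.3 (char ≠ 2)] -/
def genus_functionField_weierstrass : Prop :=
  ∀ (K : Type u) [Field K] (W : WeierstrassCurve.Affine K) [W.IsElliptic],
    genus K W.FunctionField = 1

/-- Over an infinite field `K`, the rational function field `K(X)` has infinitely many rational
places (the places `P_{X - a}`, `a ∈ K`, and `P_∞`; Stichtenoth Prop. I.2.1, so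
`#ratPlaces = #K + 1`). Contrast with abc.S14 (Mordell/Faltings) in genus `≥ 2`. [cite: Stichtenoth2009, Prop. I.2.1] -/
def infinite_ratPlaces_ratFunc : Prop :=
  ∀ (K : Type u) [Field K] [Infinite K],
    (ratPlaces K (RatFunc K)).Infinite

end AlgFunctionField

/-! ### Bridge to G16 (`Literature.NumberTheory.EllipticCurves.FunctionField.Place`, `Literature.NumberTheory.EllipticCurves.FunctionField.IsGenus`) -/

namespace AlgFunctionField

section Bridge

/- Universe `0` throughout this section: G16's `Literature.FunctionField.Place F` takes `F : Type`. -/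

variable {Fq : Type} [Field Fq] {F : Type} [Field F] [Algebra Fq F]

/-- A place of `F/𝔽_q` in the sense of this trunk (valuation ring `𝔽_q ⊆ O ⊊ F`, DVR) is a place
of `F` in the sense of G16 (`Literature.FunctionField.Place F`: valuation ring `O ⊊ F`, DVR), by
forgetting `𝔽_q ⊆ O` (Stichtenoth I.1; Rosen Ch. 5). [folklore] -/
def PlaceOver.toPlace (v : PlaceOver Fq F) : EllipticCurves.FunctionField.Place F :=
  ⟨v.toValuationSubring, v.ne_top, v.isDVR⟩

/-- The underlying valuation ring is unchanged by `toPlace`. [folklore] -/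
@[simp]
theorem PlaceOver.val_toPlace (v : PlaceOver Fq F) : (v.toPlace).1 = v.toValuationSubring :=
  rfl

/-- `toPlace` is injective (a place is determined by its valuation ring). [folklore] -/
theorem PlaceOver.toPlace_injective :
    Function.Injective (PlaceOver.toPlace (Fq := Fq) (F := F)) := fun _ _ h ↦
  PlaceOver.ext (congrArg Subtype.val h)

variable [Fintype Fq]

/-- For a function field `F/𝔽_q` of one variable, `toPlace : PlaceOver 𝔽_q F → Place F` is a
bijection: every valuation ring `O ⊊ F` contains `𝔽_q`, because the nonzero elements of `𝔽_q`
are roots of unity and valuation rings are integrally closed (Stichtenoth I.1.5; Rosen Ch. 5). [cite: Stichtenoth2009, I.1.5 (constants lie in every valuation ring)] -/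
def PlaceOver.toPlace_bijective : Prop :=
  ∀ [IsAlgFunctionField Fq F],
    Function.Bijective (PlaceOver.toPlace (Fq := Fq) (F := F))

/-- The two degrees agree: `[F_v : 𝔽_q] = log_q #F_v` when `𝔽_q` is the full constant field
(Stichtenoth Def. I.1.14, §V.1; Rosen Ch. 5; G16 `Place.residueCard_eq_pow_degree`). [cite: Stichtenoth2009, Def. I.1.14 and §V.1] -/
def PlaceOver.degree_toPlace : Prop :=
  ∀ [IsAlgFunctionField Fq F] [IsIntegrallyClosedIn Fq F] (v : PlaceOver Fq F),
    (v.toPlace).degree (Fintype.card Fq) = v.degree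

variable (Fq F) in
/-- **Bridge of genera.** For a function field `F/𝔽_q` of one variable with full constant field
`𝔽_q`, the Riemann–Roch genus `genus 𝔽_q F` (Stichtenoth Def. I.4.15) is the Weil-zeta genus of
G16, `Literature.FunctionField.IsGenus 𝔽_q F g` (the numerator of `Z(u)` has degree `2g` with inverse
roots of absolute value `√q`): Weil 1948; Stichtenoth Thm. V.1.15 and Thm. V.2.1 (Hasse–Weil),
whose proofs use Riemann–Roch; Rosen Thms. 5.9–5.10.

Constant-field conventions: here `[IsIntegrallyClosedIn Fq F]` (Mathlib: every element of `F`
integral — equivalently, algebraic — over `𝔽_q` lies in `𝔽_q`); G16 uses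
`FunctionField.IsFullConstantField Fq F := algebraicClosure Fq F = ⊥` relative to the
`Algebra Fq[X] F` structure map. For the same embedding `𝔽_q → F` the two are equivalent
(remark; not stated, since G16's predicate needs the `RatFunc Fq`-instance stack). The Betti
comparison `2 * genus = b₁` with `Literature.NumberTheory.DiophantineGeometry.genus` is NOT stated (outline §4.4). [cite: Weil1948] -/
def isGenus_genus : Prop :=
  ∀ [IsAlgFunctionField Fq F] [IsIntegrallyClosedIn Fq F],
    EllipticCurves.FunctionField.IsGenus Fq F (genus Fq F)

end Bridge

end AlgFunctionField

end Literature.NumberTheory.DiophantineGeometry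

/-! ### Discharges (D-0014 append protocol) -/

namespace Literature.NumberTheory.DiophantineGeometry

namespace AlgFunctionField

section BridgeProofs

variable {Fq : Type} [Field Fq] {F : Type} [Field F] [Algebra Fq F]

/-- Every valuation subring `O` of a field `F` containing a finite field `𝔽_q` (via `algebraMap`)
contains the image of `𝔽_q`: for `c ≠ 0` one has `c ^ (q - 1) = 1`, so if `c⁻¹ ∈ O` then
`c = (c⁻¹) ^ (q - 2) ∈ O`. This is the special case `K = 𝔽_q` of Stichtenoth Prop. I.1.5 (c)
(`K̃ ⊆ O`: elements algebraic over the constant field lie in every valuation ring), with the same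
proof. [cite: Stichtenoth2009, Prop. I.1.5(c)] -/
theorem algebraMap_mem_valuationSubring [Fintype Fq] (O : ValuationSubring F) (c : Fq) :
    algebraMap Fq F c ∈ O := by
  by_cases hc : c = 0
  · simp [hc]
  rcases O.mem_or_inv_mem (algebraMap Fq F c) with h | h
  · exact h
  · have hq : 1 ≤ Fintype.card Fq - 1 := by
      have := Fintype.one_lt_card_iff_nontrivial.mpr (inferInstance : Nontrivial Fq)
      omega
    have hc1 : (algebraMap Fq F c) ^ (Fintype.card Fq - 1) = 1 := by
      rw [← map_pow, FiniteField.pow_card_sub_one_eq_one c hc, map_one]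
    have key : algebraMap Fq F c = ((algebraMap Fq F c)⁻¹) ^ (Fintype.card Fq - 1 - 1) := by
      rw [inv_pow]
      exact eq_inv_of_mul_eq_one_left (by rw [← pow_succ', Nat.sub_add_cancel hq, hc1])
    rw [key]
    exact pow_mem h _

/-- Discharge of `PlaceOver.toPlace_bijective` (Stichtenoth Prop. I.1.5 (c), specialised to the
finite constant field `𝔽_q`): `toPlace` is injective (`toPlace_injective`) and surjective because
every valuation ring of `F` contains `𝔽_q` (`algebraMap_mem_valuationSubring`). The hypothesis
`IsAlgFunctionField 𝔽_q F` of the fact is not needed. [cite: Stichtenoth2009, Prop. I.1.5(c)] -/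
theorem PlaceOver.toPlace_bijective_holds [Fintype Fq] :
    PlaceOver.toPlace_bijective (Fq := Fq) (F := F) := by
  intro _
  refine ⟨PlaceOver.toPlace_injective, fun P ↦ ?_⟩
  exact ⟨⟨P.1, P.2.1, P.2.2, fun c ↦ algebraMap_mem_valuationSubring P.1 c⟩, rfl⟩

/-- **Discharge of `PlaceOver.degree_toPlace`.** The two degrees of a place of `F/𝔽_q` agree,
`log_q #F_v = [F_v : 𝔽_q]` (Stichtenoth Def. I.1.14 (b), p. 16, defines `deg P := [F_P : K]`;
over `K = 𝔽_q` this gives `#F_P = q ^ deg P`, the absolute norm `N(P) := q ^ deg P` of Ch. V).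
Proof: pure linear algebra over the finite field `𝔽_q` — if `F_v` is finite-dimensional then
`#F_v = q ^ [F_v : 𝔽_q]` (Mathlib `Module.natCard_eq_pow_finrank`) and `Nat.log q (q ^ d) = d`
as `1 < q`; otherwise `F_v` is infinite (`Module.finite_iff_finite`), so `Nat.card F_v = 0` and
`Module.finrank = 0`, and both sides are the documented junk value `0`. In particular the
hypotheses `[IsAlgFunctionField Fq F] [IsIntegrallyClosedIn Fq F]` of the fact are not used.
[cite: Stichtenoth2009, Def. I.1.14 and §V.1] -/
theorem PlaceOver.degree_toPlace_holds [Fintype Fq] :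
    PlaceOver.degree_toPlace (Fq := Fq) (F := F) := by
  intro _ _ v
  have hq : 1 < Fintype.card Fq := Fintype.one_lt_card
  change Nat.log (Fintype.card Fq) (Nat.card v.residueField) = Module.finrank Fq v.residueField
  by_cases hfin : Module.Finite Fq v.residueField
  · rw [Module.natCard_eq_pow_finrank (K := Fq), Nat.card_eq_fintype_card, Nat.log_pow hq]
  · have hinf : Infinite v.residueField := by
      rw [Module.finite_iff_finite] at hfin
      exact not_finite_iff_infinite.mp hfin
    rw [Module.finrank_of_not_finite hfin, Nat.card_eq_zero_of_infinite, Nat.log_zero_right]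

end BridgeProofs

end AlgFunctionField

end Literature.NumberTheory.DiophantineGeometry
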